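import Mathlib.NumberTheory.NumberField.CMField
import Mathlib.LinearAlgebra.Matrix.PosDef
import Mathlib.LinearAlgebra.Matrix.GeneralLinearGroup.Defs
import Mathlib.LinearAlgebra.Matrix.NonsingularInverse
import Mathlib.LinearAlgebra.ExteriorPower.Basic
import Mathlib.Analysis.Calculus.FDeriv.Basic
import Mathlib.Analysis.Complex.Basic
import Mathlib.GroupTheory.Index


/-! # HodgeRepro2 — definitions for the compact ball-quotient (Albanese) transfer

Blind re-derivation cell `pub-hodge-repro2`, seat p1 (definitions file). Everything here is stated in the
vocabulary of two PUBLISHED sources, read as printed through the literature tools: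

* [Sh79] G. Shimura, *Automorphic forms and the periods of abelian varieties*, J. Math. Soc. Japan 31 (1979),
  561–592: §3 (the domain `D(r,s)` of `U(r,s)`, (3.1)–(3.4)), §4 (the group `G_Q` of (4.1), the signature
  frames (4.2), the embedding (4.3), the congruence subgroup `Γ_N` of (4.14)), §8 (the ball `D_r` of (8.1) and
  Theorem 8.1, p. 588).
* [De82] P. Deligne (notes by J. Milne), *Hodge cycles on abelian varieties*, in LNM 900 (1982), §4:
  Lemma 4.3 (`⋀^d_E V` is canonically a direct summand of `⋀^d_Q V`) and Proposition 4.4 (the subspace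
  `⋀^d H¹_B(A)` of `H^d(A,Q)` is purely of bidegree `(d/2,d/2)` iff `a_σ = d/2 = b_σ` for every `σ`).

Design: the CM field is `K` with `[NumberField K] [IsCMField K]` (Mathlib), complex conjugation `ρ` is
Mathlib's `NumberField.IsCMField.complexConj K` (= `star`), so Shimura's `ᵗα^ρ` is `αᴴ`.  Abelian varieties are
NOT in Mathlib: the corner product `B = ∏ A_{T_i}` enters only through `H¹(B,Q) ≅ K⁴` (an `F`-module of rank 4)
and its Weil-class line (`weilLine`); the ball quotient enters through `Γ`-invariant holomorphic 1-forms on the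
ball itself (a 1-form on `Γ\D` IS a `Γ`-invariant 1-form on `D`).  Theorem 8.1 is recorded as a `Prop`
(`ShimuraThm81`), not asserted.  The reading of the theorem statement follows the OCR of the Collected-Papers
reprint; the literature typer's verbatim transcription (route/SOURCES.md) governs where they differ.
Deliberately NOT here: adelic/packet data (Rogawski; Dimitrov–Ramakrishnan) — a later file. -/

namespace Summit.Ventures.HodgeRepro2

open Matrix NumberField
open scoped ComplexOrder

/-! ## 1. CM types, rank-four faces, Weil-class lines -/

section CMTypes

variable (K : Type*) [Field K] [NumberField K]

/-- A CM type of the number field `K`: a set `Φ` of complex embeddings containing exactly one member of each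
complex-conjugate pair `{φ, φ̄}` ([Sh79] §4: "injections `τ_1,…,τ_g` of `K` into `C` which form a CM-type"). -/
def IsCMType (Φ : Set (K →+* ℂ)) : Prop :=
  ∀ φ : K →+* ℂ, Xor (φ ∈ Φ) (ComplexEmbedding.conjugate φ ∈ Φ)

/-- The vertices of a *rank-four face* of the cube of CM types of `K`, as used by the brief's corner products:
four CM types `T 0, …, T 3` such that every complex embedding `φ` lies in exactly two of them.  This is
precisely the condition `a_σ = d/2 = b_σ` (here `d = 4`) of [De82] Prop. 4.4 under which the Weil-class line of
`B = ∏ A_{T i}` is purely of bidegree `(2,2)`, i.e. consists of Hodge classes. -/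
def IsWeilFace (T : Fin 4 → Set (K →+* ℂ)) : Prop :=
  (∀ i, IsCMType K (T i)) ∧ ∀ φ : K →+* ℂ, Nat.card {i : Fin 4 // φ ∈ T i} = 2

/-- Conjugate CM type `Φ̄ = Φ ∘ ρ` (the "conjugate canonical model" side of the bookkeeping). -/
def conjCMType (Φ : Set (K →+* ℂ)) : Set (K →+* ℂ) :=
  {φ | ComplexEmbedding.conjugate φ ∈ Φ}

variable {K}

/-- The Weil-class line `W_K(V) = ⋀^d_K V ⊂ ⋀^d_Q V` of a `K`-vector space `V` of dimension `d`
([De82] Lemma 4.3 (b): `⋀^d_K V` is canonically a direct summand of `⋀^d_Q V`).  It is characterised without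
base change as the annihilator of the relations among `d`-th powers: `w ∈ W_K(V)` iff for every finite
`Q`-linear relation `∑ c_a a^d = 0` in `K` one has `∑ c_a (⋀^d a)(w) = 0`, where `⋀^d a` is the action of
`a ∈ K` on `⋀^d_Q V` through scalar multiplication on `V`.  Over `C` this cuts out exactly
`⊕_σ ⋀^d_C V_σ` (the `σ^d`-isotypic part, `σ` running over `Hom(K,C)`), which is Deligne's description. -/
noncomputable def weilLine (d : ℕ) (V : Type*) [AddCommGroup V] [Module K V] [Module ℚ V]
    [IsScalarTower ℚ K V] : Submodule ℚ (⋀[ℚ]^d V) :=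
  ⨅ (c : K →₀ ℚ) (_ : (c.sum fun a q => q • a ^ d) = 0),
    LinearMap.ker (c.sum fun a q => q • exteriorPower.map d ((LinearMap.lsmul K V a).restrictScalars ℚ))

/-- `H¹(B,Q)` of a corner product `B = A_{T 0} × … × A_{T 3}` of four CM abelian varieties with CM by `K`:
a free `K`-module of rank 4 (each factor contributes one `K`-line). -/
abbrev cornerH1 (K : Type*) [Field K] : Type _ := Fin 4 → K

/-- The split Weil classes of the corner product: `W_K(B) = ⋀^4_K H¹(B,Q) ⊂ ⋀^4_Q H¹(B,Q) = H⁴(B,Q)`. -/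
noncomputable abbrev cornerWeilLine (K : Type*) [Field K] [NumberField K] :
    Submodule ℚ (⋀[ℚ]^4 (cornerH1 K)) :=
  weilLine (K := K) 4 (cornerH1 K)

end CMTypes

/-! ## 2. Shimura's unitary group `G_Q`, signature frames, and the embedding (4.3) -/

section ShimuraData

variable (K : Type*) [Field K] [NumberField K] [IsCMField K]
variable {m : ℕ}

/-- [Sh79] (4.1): `G_Q = {α ∈ GL_m(K) | α T ᵗα^ρ = T}` for a fixed `T ∈ GL_m(K)` with `ᵗT^ρ = -T`
(skew-hermitian).  With `ρ = complexConj K = star`, `ᵗα^ρ` is `αᴴ`. -/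
def unitaryGroupOf (T : Matrix (Fin m) (Fin m) K) : Subgroup (GL (Fin m) K) where
  carrier := {α | (α : Matrix (Fin m) (Fin m) K) * T * (α : Matrix (Fin m) (Fin m) K)ᴴ = T}
  one_mem' := by simp
  mul_mem' := by
    intro α β hα hβ
    simp only [Set.mem_setOf_eq] at hα hβ ⊢
    have e : ((α * β : GL (Fin m) K) : Matrix (Fin m) (Fin m) K) =
        (α : Matrix (Fin m) (Fin m) K) * (β : Matrix (Fin m) (Fin m) K) := Units.val_mul α β
    rw [e, conjTranspose_mul]
    calc (α : Matrix (Fin m) (Fin m) K) * (β : Matrix (Fin m) (Fin m) K) * T *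
          ((β : Matrix (Fin m) (Fin m) K)ᴴ * (α : Matrix (Fin m) (Fin m) K)ᴴ)
        = (α : Matrix (Fin m) (Fin m) K) * ((β : Matrix (Fin m) (Fin m) K) * T *
            (β : Matrix (Fin m) (Fin m) K)ᴴ) * (α : Matrix (Fin m) (Fin m) K)ᴴ := by
          simp only [Matrix.mul_assoc]
      _ = T := by rw [hβ, hα]
  inv_mem' := by
    intro α hα
    simp only [Set.mem_setOf_eq] at hα ⊢
    have e : ((α⁻¹ : GL (Fin m) K) : Matrix (Fin m) (Fin m) K) * (α : Matrix (Fin m) (Fin m) K) = 1 :=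
      Units.inv_mul α
    calc ((α⁻¹ : GL (Fin m) K) : Matrix (Fin m) (Fin m) K) * T *
          ((α⁻¹ : GL (Fin m) K) : Matrix (Fin m) (Fin m) K)ᴴ
        = ((α⁻¹ : GL (Fin m) K) : Matrix (Fin m) (Fin m) K) *
            ((α : Matrix (Fin m) (Fin m) K) * T * (α : Matrix (Fin m) (Fin m) K)ᴴ) *
            ((α⁻¹ : GL (Fin m) K) : Matrix (Fin m) (Fin m) K)ᴴ := by rw [hα]
      _ = (((α⁻¹ : GL (Fin m) K) : Matrix (Fin m) (Fin m) K) * (α : Matrix (Fin m) (Fin m) K)) * T *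
            (((α⁻¹ : GL (Fin m) K) : Matrix (Fin m) (Fin m) K) * (α : Matrix (Fin m) (Fin m) K))ᴴ := by
          rw [conjTranspose_mul]; simp only [Matrix.mul_assoc]
      _ = T := by rw [e]; simp

/-- Skew-hermitian: `ᵗT^ρ = -T` ([Sh79] §4, the Riemann form `E(p(x),p(y)) = Tr_{K/Q}(x T ᵗy^ρ)`). -/
def IsSkewHermitian (T : Matrix (Fin m) (Fin m) K) : Prop := Tᴴ = -T

/-- `J_{r,s} = diag[1_r, -1_s]` of [Sh79] §3, as an `m × m` matrix with `s = m - r`. -/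
def Jrs (m r : ℕ) : Matrix (Fin m) (Fin m) ℂ :=
  diagonal fun i => if (i : ℕ) < r then 1 else -1

/-- [Sh79] (4.2): a *signature frame* `Q ∈ GL_m(C)` for `T` at the embedding `τ`:
`-i T^τ = Q^ρ J_{r,s} ᵗQ`, which says that the hermitian matrix `-i T^τ` has signature `(r, s)`, `s = m - r`. -/
def IsSignatureFrame (T : Matrix (Fin m) (Fin m) K) (τ : K →+* ℂ) (r : ℕ) (Q : GL (Fin m) ℂ) : Prop :=
  (-Complex.I) • T.map τ = (Q : Matrix (Fin m) (Fin m) ℂ).map (starRingEnd ℂ) * Jrs m r * (Q : Matrix (Fin m) (Fin m) ℂ)ᵀ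

/-- `-i T^τ` has signature `(r, m - r)`: some frame exists. -/
def HasSignatureAt (T : Matrix (Fin m) (Fin m) K) (τ : K →+* ℂ) (r : ℕ) : Prop :=
  ∃ Q : GL (Fin m) ℂ, IsSignatureFrame K T τ r Q

/-- [Sh79] (4.3), one factor: the embedding `α ↦ Q_ν⁻¹ α^{τ_ν ρ} Q_ν` of `G_Q` into `U(r_ν, s_ν)`, for the
embedding `τ = τ_ν` and frame `Q = Q_ν`.  (`α^{τρ}` is the entrywise image under the conjugate embedding `τ̄`.) -/
def embedAt (τ : K →+* ℂ) (Q : GL (Fin m) ℂ) (α : Matrix (Fin m) (Fin m) K) :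
    Matrix (Fin m) (Fin m) ℂ :=
  ((Q⁻¹ : GL (Fin m) ℂ) : Matrix (Fin m) (Fin m) ℂ) * α.map (ComplexEmbedding.conjugate τ) *
    (Q : Matrix (Fin m) (Fin m) ℂ)

/-! ## 3. The lattice `𝔪` and the congruence subgroup `Γ_N` of (4.14) -/

/-- A full `Z`-lattice `𝔪` in the row space `K^1_m` ([Sh79] (4.15): `𝔪 = ∑ Z h_j` for a `Q`-basis `h_j`). -/
def IsFullLattice (𝔪 : Submodule ℤ (Fin m → K)) : Prop :=
  Module.Finite ℤ 𝔪 ∧ Submodule.span ℚ (𝔪 : Set (Fin m → K)) = ⊤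

/-- [Sh79] (4.14): `Γ_N = {γ ∈ G_Q | det γ = 1, 𝔪γ = 𝔪, 𝔪(1 - γ) ⊂ N𝔪}` (`G_Q` acts on row vectors from the
right, `x ↦ xγ`).  `𝔪γ = 𝔪` is recorded as `𝔪γ ⊆ 𝔪` and `𝔪γ⁻¹ ⊆ 𝔪`. -/
def congruenceSubgroup (T : Matrix (Fin m) (Fin m) K) (𝔪 : Submodule ℤ (Fin m → K)) (N : ℕ) :
    Subgroup (GL (Fin m) K) where
  carrier := {γ | γ ∈ unitaryGroupOf K T ∧ det (γ : Matrix (Fin m) (Fin m) K) = 1 ∧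
    (∀ x ∈ 𝔪, vecMul x (γ : Matrix (Fin m) (Fin m) K) ∈ 𝔪) ∧
    (∀ x ∈ 𝔪, vecMul x ((γ⁻¹ : GL (Fin m) K) : Matrix (Fin m) (Fin m) K) ∈ 𝔪) ∧
    ∀ x ∈ 𝔪, ∃ y ∈ 𝔪, x - vecMul x (γ : Matrix (Fin m) (Fin m) K) = (N : ℤ) • y}
  one_mem' := by
    refine ⟨one_mem _, by simp, fun x hx => by simpa using hx, fun x hx => by simpa using hx,
      fun x hx => ⟨0, zero_mem _, by simp⟩⟩
  mul_mem' := by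
    intro γ δ hγ hδ
    obtain ⟨hγ₁, hγ₂, hγ₃, hγ₄, hγ₅⟩ := hγ
    obtain ⟨hδ₁, hδ₂, hδ₃, hδ₄, hδ₅⟩ := hδ
    refine ⟨mul_mem hγ₁ hδ₁, by simp [hγ₂, hδ₂], ?_, ?_, ?_⟩
    · intro x hx
      simpa only [Units.val_mul, ← vecMul_vecMul] using hδ₃ _ (hγ₃ x hx)
    · intro x hx
      rw [_root_.mul_inv_rev, Units.val_mul, ← vecMul_vecMul]
      exact hγ₄ _ (hδ₄ x hx)
    · intro x hx
      obtain ⟨y₁, hy₁, e₁⟩ := hγ₅ x hx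
      obtain ⟨y₂, hy₂, e₂⟩ := hδ₅ _ (hγ₃ x hx)
      refine ⟨y₁ + y₂, add_mem hy₁ hy₂, ?_⟩
      rw [smul_add, ← e₁, ← e₂, Units.val_mul, ← vecMul_vecMul]
      abel
  inv_mem' := by
    intro γ hγ
    obtain ⟨hγ₁, hγ₂, hγ₃, hγ₄, hγ₅⟩ := hγ
    refine ⟨inv_mem hγ₁, ?_, ?_, ?_, ?_⟩
    · have h := congrArg Matrix.det (Units.inv_mul γ)
      rw [det_mul, hγ₂, mul_one, det_one] at h
      exact h
    · intro x hx; exact hγ₄ x hx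
    · intro x hx; simpa using hγ₃ x hx
    · intro x hx
      obtain ⟨y, hy, e⟩ := hγ₅ _ (hγ₄ x hx)
      refine ⟨-y, neg_mem hy, ?_⟩
      rw [smul_neg, ← e, vecMul_vecMul, Units.inv_mul, vecMul_one]
      abel

/-! ## 4. The ball `D_r`, the action of `U(r,1)`, and holomorphic 1-forms -/

/-- [Sh79] (8.1): `D_r = D(r,1) = {z ∈ C^r | ∑ |z_k|² < 1}` (the complex `r`-ball; `r = 2` is the Picard case). -/
def complexBall (r : ℕ) : Set (Fin r → ℂ) := {z | ∑ k, ‖z k‖ ^ 2 < 1}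

/-- [Sh79] (3.3)–(3.4) for `s = 1`: writing `β = [[A, b], [c, d]] ∈ U(r,1)` in blocks of sizes `r + 1`, the
action on the ball is `β(z) = (A z + b)(c z + d)⁻¹`. -/
noncomputable def ballAction {r : ℕ} (β : Matrix (Fin (r + 1)) (Fin (r + 1)) ℂ) (z : Fin r → ℂ) : Fin r → ℂ :=
  fun k => (∑ j, β (Fin.castSucc k) (Fin.castSucc j) * z j + β (Fin.castSucc k) (Fin.last r)) /
    (∑ j, β (Fin.last r) (Fin.castSucc j) * z j + β (Fin.last r) (Fin.last r))

/-- A closed holomorphic 1-form `ξ = ∑_j f_j dz_j` on the ball `D_r`, encoded by its coefficient vector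
`f = coeff : C^r → C^r`: `f` is holomorphic on the ball and `∂_j f_k = ∂_k f_j` there (`dξ = 0`). -/
structure ClosedHolomorphicOneForm (r : ℕ) where
  /-- the coefficients `f_j` of `ξ = ∑_j f_j dz_j` -/
  coeff : (Fin r → ℂ) → (Fin r → ℂ)
  /-- holomorphic on the ball -/
  holo : DifferentiableOn ℂ coeff (complexBall r)
  /-- closed: `∂_j f_k = ∂_k f_j` on the ball -/
  closed : ∀ z ∈ complexBall r, ∀ j k : Fin r,
    fderiv ℂ coeff z (Pi.single j 1) k = fderiv ℂ coeff z (Pi.single k 1) j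

/-- `ξ` is invariant under `β`: `β^* ξ = ξ`, i.e. `ξ_{β z}(Dβ_z v) = ξ_z(v)` for `z` in the ball and all `v`.
A 1-form on the quotient `Γ\D_r` is exactly a 1-form on `D_r` invariant under every `γ ∈ Γ`. -/
def IsInvariantUnder {r : ℕ} (ξ : ClosedHolomorphicOneForm r)
    (β : Matrix (Fin (r + 1)) (Fin (r + 1)) ℂ) : Prop :=
  ∀ z ∈ complexBall r, ∀ v : Fin r → ℂ,
    ∑ k, ξ.coeff (ballAction β z) k * fderiv ℂ (ballAction β) z v k = ∑ k, ξ.coeff z k * v k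

/-- `ξ_1 ∧ ⋯ ∧ ξ_r ≠ 0` on the ball: the holomorphic `r`-form `det(f_{k,j}) dz_1 ∧ ⋯ ∧ dz_r` is not
identically zero, i.e. `det (f_{k j}(z)) ≠ 0` at some point `z` of the ball. -/
def WedgeNonzero {r : ℕ} (ξ : Fin r → ClosedHolomorphicOneForm r) : Prop :=
  ∃ z ∈ complexBall r, det (Matrix.of fun k j => (ξ k).coeff z j) ≠ 0

/-! ## 5. Shimura's Theorem 8.1 as printed (hypotheses and conclusion as a `Prop`) -/

/-- The data of [Sh79] §4 specialised to the hypothesis of Theorem 8.1: `K` a CM field, `T ∈ GL_m(K)`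
skew-hermitian, a CM type `Φ = {τ_1, …, τ_g}` of `K` with a distinguished member `τ = τ_1`, a frame `Q = Q_1`
exhibiting signature `(r_1, s_1) = (m - 1, 1)` for `-i T^{τ_1}` (so `s_1 = 1`), positive definiteness of
`-i T^{τ_ν}` for `ν ≥ 2` (so `s_2 = ⋯ = s_g = 0`, `D = D_{m-1}`), and an arbitrary full lattice `𝔪 ⊂ K^1_m`.
Here `m = r + 1`, `r` = the ball dimension. -/
structure Thm81Data (r : ℕ) where
  /-- the skew-hermitian matrix `T` -/
  T : Matrix (Fin (r + 1)) (Fin (r + 1)) K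
  /-- `ᵗT^ρ = -T` -/
  skew : IsSkewHermitian K T
  /-- the CM type `{τ_1, …, τ_g}` -/
  Φ : Set (K →+* ℂ)
  /-- it is a CM type -/
  cmtype : IsCMType K Φ
  /-- the distinguished embedding `τ_1` -/
  τ : K →+* ℂ
  /-- `τ_1 ∈ Φ` -/
  τ_mem : τ ∈ Φ
  /-- the frame `Q_1` at `τ_1` -/
  Q : GL (Fin (r + 1)) ℂ
  /-- `-i T^{τ_1} = Q_1^ρ J_{r,1} ᵗQ_1`: signature `(r, 1)`, i.e. `s_1 = 1` -/
  frame : IsSignatureFrame K T τ r Q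
  /-- `-i T^{τ_ν} > 0` for `ν ≥ 2`: `s_ν = 0` -/
  definite : ∀ τ' ∈ Φ, τ' ≠ τ → ((-Complex.I) • T.map τ').PosDef
  /-- the lattice `𝔪` -/
  𝔪 : Submodule ℤ (Fin (r + 1) → K)
  /-- `𝔪` is a full lattice in `K^1_m` -/
  lattice : IsFullLattice K 𝔪

variable {K}

/-- `Γ_1` of (4.14) with `N = 1` for the data `D`. -/
def Thm81Data.Gamma1 {r : ℕ} (D : Thm81Data K r) : Subgroup (GL (Fin (r + 1)) K) :=
  congruenceSubgroup K D.T D.𝔪 1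

/-- The conclusion of [Sh79] Theorem 8.1 for the data `D` (reading of the printed statement): there is a
subgroup `Γ' ⊂ Γ_1` of finite index and `m - 1 = r` closed holomorphic 1-forms `ξ_1, …, ξ_r` on `Γ'\D_r`
(`Γ'` acting through the embedding (4.3) at `τ_1`) with `ξ_1 ∧ ⋯ ∧ ξ_r ≠ 0`.  (For a compact quotient, which is
the case when `[K:Q] > 2`, a non-zero holomorphic 1-form is never exact, so each `ξ_k` has non-zero cohomology
class, as the theorem also asserts.) -/
def Thm81Conclusion {r : ℕ} (D : Thm81Data K r) : Prop :=
  ∃ Γ' : Subgroup (GL (Fin (r + 1)) K), Γ' ≤ D.Gamma1 ∧ Γ'.relIndex D.Gamma1 ≠ 0 ∧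
    ∃ ξ : Fin r → ClosedHolomorphicOneForm r,
      (∀ k, ∀ γ ∈ Γ', IsInvariantUnder (ξ k) (embedAt K D.τ D.Q (γ : Matrix (Fin (r + 1)) (Fin (r + 1)) K))) ∧
      WedgeNonzero ξ

variable (K)

/-- [Sh79] Theorem 8.1 (p. 588) as a named fact (statement only, not asserted): for every datum satisfying the
printed hypotheses with `m = r + 1`, the conclusion holds.  `r = 2` is the compact Picard modular surface case
of the transfer (`[K:Q] = 2g > 2` makes `Γ\D_2` compact, [Sh79] remark after Thm 8.1). -/
def ShimuraThm81 (r : ℕ) : Prop :=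
  ∀ D : Thm81Data K r, Thm81Conclusion D

/-- The remark after [Sh79] Thm 8.1: under its hypotheses `Γ\D` is compact iff `g > 1`, i.e. `[K:Q] > 2`. -/
def IsCompactCase : Prop := 2 < Module.finrank ℚ K

end ShimuraData

end Summit.Ventures.HodgeRepro2
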